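import Mathlib.Algebra.Field.ZMod
import Mathlib.Algebra.Module.ZMod
import Mathlib.GroupTheory.Commutator.Basic
import Mathlib.GroupTheory.QuotientGroup.Basic
import Mathlib.GroupTheory.Index
import Mathlib.LinearAlgebra.Dimension.Free
import Mathlib.LinearAlgebra.FiniteDimensional.Defs
import Mathlib.Data.List.OfFn
import Mathlib.Tactic.Group
import Mathlib.Tactic.FinCases
import HarnessLib

/-!
# Crux `Capture` (stmt-PneNP-2659), line `csp-spine-meet-to-join` rev 4, Stub S: `stub_twoStepStructure`
A finite group with all squares central and `g⁴ = 1` has BILINEAR TWO-STEP COORDINATES `G ≃ 𝔽₂^k × 𝔽₂^l`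
(`x` additive, `z (g h) = z g + z h + β (x g) (x h)`, `β` bi-additive): `Z = {central elements of order ≤ 2}`
contains all squares, hence all commutators; `x` = coordinates in an `𝔽₂`-basis of `G/Z`; `λ a = ∏ᵢ gᵢ^{aᵢ}`
the ORDERED product of lifts of the basis; `z g` = coordinates of `λ(x g)⁻¹ g ∈ Z`; the cocycle of `λ` is
bi-multiplicative by induction on `k` (`ts_cocycle`). Continuation lead c1, 2026-08-16. [folklore]
-/

namespace Summit.PneNP.PneNP.Cruxes.Capture.CspSpineMeetToJoin

set_option linter.dupNamespace false -- `Summit.PneNP.PneNP.…`: summit = sub-problem (D-0017)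

open scoped commutatorElement

/-- The two values of `ZMod 2` together with their `val`. [folklore] -/
theorem ts_zmod2 (c : ZMod 2) : (c = 0 ∧ c.val = 0) ∨ (c = 1 ∧ c.val = 1) := by revert c; decide

/-- `g^m g^n = g^{(m+n) mod 2} (g²)^{mn}` for `m, n < 2`. [folklore] -/
theorem ts_pow_cases {G : Type*} [Group G] (g : G) (m n : ℕ) (hm : m < 2) (hn : n < 2) :
    g ^ m * g ^ n = g ^ ((m + n) % 2) * (g ^ 2) ^ (m * n) := by
  interval_cases m <;> interval_cases n <;> simp [pow_two]

/-- Period two: `(g²)^{((ma+mc) mod 2)·n} = (g²)^{ma n} (g²)^{mc n}` when `(g²)^e` only depends on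
`e mod 2` and `ma, mc, n < 2`. [folklore] -/
theorem ts_sq_cases {G : Type*} [Group G] (g : G) (h : ∀ e : ℕ, (g ^ 2) ^ e = (g ^ 2) ^ (e % 2))
    (ma mc n : ℕ) (hma : ma < 2) (hmc : mc < 2) (hn : n < 2) :
    (g ^ 2) ^ ((ma + mc) % 2 * n) = (g ^ 2) ^ (ma * n) * (g ^ 2) ^ (mc * n) := by
  rw [← pow_add, h (ma * n + mc * n)]
  interval_cases ma <;> interval_cases mc <;> interval_cases n <;> simp

/-- `g^{(ma+mc) mod 2} = g^{ma} g^{mc} u` with `u ∈ {1, g²}` when `g² g² = 1`, `ma, mc < 2`. [folklore] -/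
theorem ts_split_cases {G : Type*} [Group G] (g : G) (hg4 : g ^ 2 * g ^ 2 = 1) (ma mc : ℕ)
    (hma : ma < 2) (hmc : mc < 2) :
    ∃ u : G, (u = 1 ∨ u = g ^ 2) ∧ g ^ ((ma + mc) % 2) = g ^ ma * g ^ mc * u := by
  interval_cases ma <;> interval_cases mc
  · exact ⟨1, Or.inl rfl, by simp⟩
  · exact ⟨1, Or.inl rfl, by simp⟩
  · exact ⟨1, Or.inl rfl, by simp⟩
  · refine ⟨g ^ 2, Or.inr rfl, ?_⟩
    have h2 : (1 + 1) % 2 = 0 := by norm_num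
    rw [h2, pow_zero, pow_one, ← pow_two, hg4]

/-- Period two of the powers of an element whose square squares to one. [folklore] -/
theorem ts_per {G : Type*} [Group G] (g : G) (hg4 : g ^ 2 * g ^ 2 = 1) (e : ℕ) :
    (g ^ 2) ^ e = (g ^ 2) ^ (e % 2) := by
  have hsq4 : (g ^ 2) ^ 2 = 1 := by rw [pow_two (g ^ 2)]; exact hg4
  conv_lhs => rw [← Nat.mod_add_div e 2]
  rw [pow_add, pow_mul, hsq4, one_pow, mul_one]

section TwoStepAux
variable {G : Type*} [Group G] (Z : Subgroup G)
variable (hZc : ∀ c ∈ Z, ∀ y : G, c * y = y * c) (hsqZ : ∀ a : G, a ^ 2 ∈ Z)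
include hZc hsqZ

/-- Commutators are products of three squares, hence lie in `Z`. [folklore] -/
theorem ts_comm_mem (a b : G) : ⁅a, b⁆ ∈ Z := by
  have hsq' : ∀ u y : G, u * u * y = y * (u * u) := fun u y => by
    have := hZc _ (hsqZ u) y; rwa [pow_two] at this
  have sq : ∀ u : G, u * u ∈ Z := fun u => by have := hsqZ u; rwa [pow_two] at this
  have key : ⁅a, b⁆ = a * b * (a * b) * (b⁻¹ * b⁻¹ * (a⁻¹ * a⁻¹)) := by
    rw [commutatorElement_def]
    calc a * b * a⁻¹ * b⁻¹ = a * b * (a * b) * (b⁻¹ * (a⁻¹ * a⁻¹ * b⁻¹)) := by group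
      _ = a * b * (a * b) * (b⁻¹ * (b⁻¹ * (a⁻¹ * a⁻¹))) := by rw [hsq' a⁻¹ b⁻¹]
      _ = a * b * (a * b) * (b⁻¹ * b⁻¹ * (a⁻¹ * a⁻¹)) := by group
  rw [key]
  exact Z.mul_mem (sq _) (Z.mul_mem (sq _) (sq _))

/-- `κ(p,q) = p⁻¹ q⁻¹ p q` lies in `Z`. [folklore] -/
theorem ts_kappa_mem (p q : G) : p⁻¹ * q⁻¹ * p * q ∈ Z := by
  have : p⁻¹ * q⁻¹ * p * q = ⁅p⁻¹, q⁻¹⁆ := by rw [commutatorElement_def]; group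
  rw [this]; exact ts_comm_mem Z hZc hsqZ _ _

/-- Commutators are central. [folklore] -/
theorem ts_hc (a b y : G) : ⁅a, b⁆ * y = y * ⁅a, b⁆ := hZc _ (ts_comm_mem Z hZc hsqZ a b) y

/-- `κ` is multiplicative on the left (central commutators are bi-multiplicative, cf.
`baer_comm_mul_left` of `ConvexRankGatesCaptureBaerCoset`, re-derived inline). [folklore] -/
theorem ts_kappa_mul_left (p p' q : G) :
    (p * p')⁻¹ * q⁻¹ * (p * p') * q = (p⁻¹ * q⁻¹ * p * q) * (p'⁻¹ * q⁻¹ * p' * q) := by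
  have hc := ts_hc Z hZc hsqZ
  have hml : ∀ a b c : G, ⁅a * b, c⁆ = ⁅a, c⁆ * ⁅b, c⁆ := fun a b c => by
    have h1 : ⁅a * b, c⁆ = a * ⁅b, c⁆ * a⁻¹ * ⁅a, c⁆ := by simp only [commutatorElement_def]; group
    rw [h1, ← hc b c a, show ⁅b, c⁆ * a * a⁻¹ * ⁅a, c⁆ = ⁅b, c⁆ * ⁅a, c⁆ by group, hc b c ⁅a, c⁆]
  have e : ∀ u v : G, u⁻¹ * v⁻¹ * u * v = ⁅u⁻¹, v⁻¹⁆ := fun u v => by rw [commutatorElement_def]; group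
  rw [e, e, e, mul_inv_rev, hml]
  exact (hZc _ (ts_comm_mem Z hZc hsqZ _ _) _).symm ▸ rfl

/-- `κ` is multiplicative on the right. [folklore] -/
theorem ts_kappa_mul_right (p q q' : G) :
    p⁻¹ * (q * q')⁻¹ * p * (q * q') = (p⁻¹ * q⁻¹ * p * q) * (p⁻¹ * q'⁻¹ * p * q') := by
  have hc := ts_hc Z hZc hsqZ
  have hmr : ∀ a b c : G, ⁅a, b * c⁆ = ⁅a, b⁆ * ⁅a, c⁆ := fun a b c => by
    have h1 : ⁅a, b * c⁆ = ⁅a, b⁆ * (b * ⁅a, c⁆ * b⁻¹) := by simp only [commutatorElement_def]; group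
    rw [h1, ← hc a c b]; group
  have e : ∀ u v : G, u⁻¹ * v⁻¹ * u * v = ⁅u⁻¹, v⁻¹⁆ := fun u v => by rw [commutatorElement_def]; group
  rw [e, e, e, mul_inv_rev, hmr]
  exact hZc _ (ts_comm_mem Z hZc hsqZ _ _) _

omit hsqZ in
/-- `κ(p, c) = 1` for `c ∈ Z`. [folklore] -/
theorem ts_kappa_central_right (p c : G) (hc : c ∈ Z) : p⁻¹ * c⁻¹ * p * c = 1 := by
  rw [show p⁻¹ * c⁻¹ * p * c = p⁻¹ * c⁻¹ * (p * c) by group, ← hZc c hc p]; group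

omit hsqZ in
/-- `κ(c, q) = 1` for `c ∈ Z`. [folklore] -/
theorem ts_kappa_central_left (c q : G) (hc : c ∈ Z) : c⁻¹ * q⁻¹ * c * q = 1 := by
  rw [show c⁻¹ * q⁻¹ * c * q = c⁻¹ * (q⁻¹ * c) * q by group, ← hZc c hc q⁻¹]; group

omit hsqZ in
/-- Central factors rearrange: `s₁ s₂ (d₁ d₂) (k₁ k₂) = (s₁ d₁ k₁)(s₂ d₂ k₂)` for `s₂, d₂ ∈ Z`. [folklore] -/
theorem ts_rearrange (s₁ s₂ d₁ d₂ k₁ k₂ : G) (hs₂ : s₂ ∈ Z) (hd₂ : d₂ ∈ Z) :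
    s₁ * s₂ * (d₁ * d₂) * (k₁ * k₂) = s₁ * d₁ * k₁ * (s₂ * d₂ * k₂) :=
  calc s₁ * s₂ * (d₁ * d₂) * (k₁ * k₂) = s₁ * (s₂ * d₁) * d₂ * k₁ * k₂ := by group
    _ = s₁ * (d₁ * s₂) * d₂ * k₁ * k₂ := by rw [hZc s₂ hs₂ d₁]
    _ = s₁ * d₁ * (s₂ * d₂ * k₁) * k₂ := by group
    _ = s₁ * d₁ * (k₁ * (s₂ * d₂)) * k₂ := by rw [hZc _ (Z.mul_mem hs₂ hd₂) k₁]
    _ = s₁ * d₁ * k₁ * (s₂ * d₂ * k₂) := by group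

/-- **The ordered-product section has a bi-multiplicative cocycle.** For lifts `gen : Fin k → G`
put `λ a = ∏ᵢ (gen i)^{(a i).val}` (ordered). Then `λ a * λ b = λ (a + b) * D a b` with `D a b ∈ Z`
bi-multiplicative — provided every element of `Z` squares to `1` (so that `(g²)²  = 1`). [folklore] -/
theorem ts_cocycle (hZ2 : ∀ c ∈ Z, c * c = 1) : ∀ (k : ℕ) (gen : Fin k → G),
    ∃ D : (Fin k → ZMod 2) → (Fin k → ZMod 2) → G,
      (∀ a b, D a b ∈ Z) ∧
      (∀ a b, (List.ofFn fun i => gen i ^ (a i).val).prod * (List.ofFn fun i => gen i ^ (b i).val).prod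
        = (List.ofFn fun i => gen i ^ ((a + b) i).val).prod * D a b) ∧
      (∀ a a' b, D (a + a') b = D a b * D a' b) ∧
      (∀ a b b', D a (b + b') = D a b * D a b') := by
  intro k; induction k with
  | zero => exact fun gen => ⟨fun _ _ => 1, fun _ _ => Z.one_mem, fun a b => by simp,
      fun _ _ _ => by simp, fun _ _ _ => by simp⟩
  | succ k ih =>
    intro gen
    obtain ⟨D', hD'Z, hD'prod, hD'l, hD'r⟩ := ih (fun i => gen (Fin.castSucc i))
    set g : G := gen (Fin.last k) with hg; set lam' : (Fin k → ZMod 2) → G :=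
      fun a => (List.ofFn fun i => gen (Fin.castSucc i) ^ (a i).val).prod with hlam'
    have hsplit : ∀ a : Fin (k + 1) → ZMod 2, (List.ofFn fun i => gen i ^ (a i).val).prod =
        lam' (fun i => a (Fin.castSucc i)) * g ^ (a (Fin.last k)).val := fun a => by
      rw [List.ofFn_succ', List.prod_concat]
    have hD'prod' : ∀ a b : Fin k → ZMod 2, lam' a * lam' b = lam' (a + b) * D' a b :=
      fun a b => hD'prod a b
    refine ⟨fun a b => (g ^ 2) ^ ((a (Fin.last k)).val * (b (Fin.last k)).val) *
        D' (fun i => a (Fin.castSucc i)) (fun i => b (Fin.castSucc i)) *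
        ((g ^ (a (Fin.last k)).val)⁻¹ * (lam' (fun i => b (Fin.castSucc i)))⁻¹ *
          g ^ (a (Fin.last k)).val * lam' (fun i => b (Fin.castSucc i))), ?_, ?_, ?_, ?_⟩
    · -- membership in `Z`
      intro a b
      exact Z.mul_mem (Z.mul_mem (Z.pow_mem (hsqZ g) _) (hD'Z _ _)) (ts_kappa_mem Z hZc hsqZ _ _)
    · -- the product identity
      intro a b
      set a' : Fin k → ZMod 2 := fun i => a (Fin.castSucc i) with ha'; set b' : Fin k → ZMod 2 := fun i => b (Fin.castSucc i) with hb'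
      set m : ℕ := (a (Fin.last k)).val with hm; set n : ℕ := (b (Fin.last k)).val with hn
      have hab' : (fun i => (a + b) (Fin.castSucc i)) = a' + b' := rfl
      rw [hsplit a, hsplit b, hsplit (a + b), hab']
      set κ₁ : G := (g ^ m)⁻¹ * (lam' b')⁻¹ * g ^ m * lam' b' with hκ₁
      have hκ₁Z : κ₁ ∈ Z := ts_kappa_mem Z hZc hsqZ _ _
      have hpow : g ^ m * g ^ n = g ^ ((a + b) (Fin.last k)).val * (g ^ 2) ^ (m * n) := by
        have hs : ((a + b) (Fin.last k)).val = (m + n) % 2 := by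
          rw [Pi.add_apply, ZMod.val_add]
        rw [hs]
        exact ts_pow_cases g m n (ZMod.val_lt _) (ZMod.val_lt _)
      calc lam' a' * g ^ m * (lam' b' * g ^ n)
          = lam' a' * (g ^ m * lam' b') * g ^ n := by group
        _ = lam' a' * (lam' b' * g ^ m * κ₁) * g ^ n := by
            congr 2; rw [hκ₁]; group
        _ = lam' a' * lam' b' * g ^ m * (κ₁ * g ^ n) := by group
        _ = lam' a' * lam' b' * g ^ m * (g ^ n * κ₁) := by rw [hZc κ₁ hκ₁Z]
        _ = (lam' a' * lam' b') * (g ^ m * g ^ n) * κ₁ := by group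
        _ = (lam' (a' + b') * D' a' b') * (g ^ m * g ^ n) * κ₁ := by rw [hD'prod' a' b']
        _ = lam' (a' + b') * (D' a' b' * (g ^ m * g ^ n)) * κ₁ := by group
        _ = lam' (a' + b') * ((g ^ m * g ^ n) * D' a' b') * κ₁ := by rw [hZc _ (hD'Z a' b')]
        _ = lam' (a' + b') * (g ^ ((a + b) (Fin.last k)).val * (g ^ 2) ^ (m * n) * D' a' b') * κ₁ := by
            rw [hpow]
        _ = lam' (a' + b') * g ^ ((a + b) (Fin.last k)).val *
              ((g ^ 2) ^ (m * n) * D' a' b' * κ₁) := by group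
    · -- additivity in the first argument
      intro a c b
      set a' : Fin k → ZMod 2 := fun i => a (Fin.castSucc i) with ha'; set c' : Fin k → ZMod 2 := fun i => c (Fin.castSucc i) with hc'
      set b' : Fin k → ZMod 2 := fun i => b (Fin.castSucc i) with hb'
      have hac' : (fun i => (a + c) (Fin.castSucc i)) = a' + c' := rfl
      simp only [hac']
      set L : G := lam' b' with hL; set ma : ℕ := (a (Fin.last k)).val with hma; set mc : ℕ := (c (Fin.last k)).val with hmc
      set n : ℕ := (b (Fin.last k)).val with hn
      have hg2 : g ^ 2 ∈ Z := hsqZ g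
      have hg4 : g ^ 2 * g ^ 2 = 1 := hZ2 _ hg2
      have hper := ts_per g hg4
      have hsac : ((a + c) (Fin.last k)).val = (ma + mc) % 2 := by
        rw [Pi.add_apply, ZMod.val_add]
      have hsq_part : (g ^ 2) ^ (((a + c) (Fin.last k)).val * n) =
          (g ^ 2) ^ (ma * n) * (g ^ 2) ^ (mc * n) := by
        rw [hsac]
        exact ts_sq_cases g hper ma mc n (ZMod.val_lt _) (ZMod.val_lt _) (ZMod.val_lt _)
      have hκ_part : (g ^ ((a + c) (Fin.last k)).val)⁻¹ * L⁻¹ * g ^ ((a + c) (Fin.last k)).val * L =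
          ((g ^ ma)⁻¹ * L⁻¹ * g ^ ma * L) * ((g ^ mc)⁻¹ * L⁻¹ * g ^ mc * L) := by
        obtain ⟨u, huZ, hu⟩ : ∃ u ∈ Z, g ^ ((a + c) (Fin.last k)).val = g ^ ma * g ^ mc * u := by
          obtain ⟨u, hu1, hu⟩ := ts_split_cases g hg4 ma mc (ZMod.val_lt _) (ZMod.val_lt _)
          refine ⟨u, ?_, by rw [hsac]; exact hu⟩
          rcases hu1 with rfl | rfl
          · exact Z.one_mem
          · exact hg2
        rw [hu, ts_kappa_mul_left Z hZc hsqZ, ts_kappa_mul_left Z hZc hsqZ,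
          ts_kappa_central_left Z hZc u L huZ, mul_one]
      rw [hsq_part, hD'l, hκ_part]
      exact ts_rearrange Z hZc _ _ _ _ _ _ (Z.pow_mem hg2 _) (hD'Z _ _)
    · -- additivity in the second argument
      intro a b c
      set a' : Fin k → ZMod 2 := fun i => a (Fin.castSucc i) with ha'; set b' : Fin k → ZMod 2 := fun i => b (Fin.castSucc i) with hb'
      set c' : Fin k → ZMod 2 := fun i => c (Fin.castSucc i) with hc'
      have hbc' : (fun i => (b + c) (Fin.castSucc i)) = b' + c' := rfl
      simp only [hbc']
      set m : ℕ := (a (Fin.last k)).val with hm; set nb : ℕ := (b (Fin.last k)).val with hnb; set nc : ℕ := (c (Fin.last k)).val with hnc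
      have hg2 : g ^ 2 ∈ Z := hsqZ g
      have hg4 : g ^ 2 * g ^ 2 = 1 := hZ2 _ hg2
      have hper := ts_per g hg4
      have hsbc : ((b + c) (Fin.last k)).val = (nb + nc) % 2 := by
        rw [Pi.add_apply, ZMod.val_add]
      have hsq_part : (g ^ 2) ^ (m * ((b + c) (Fin.last k)).val) =
          (g ^ 2) ^ (m * nb) * (g ^ 2) ^ (m * nc) := by
        rw [hsbc, Nat.mul_comm m, Nat.mul_comm m nb, Nat.mul_comm m nc]
        exact ts_sq_cases g hper nb nc m (ZMod.val_lt _) (ZMod.val_lt _) (ZMod.val_lt _)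
      have hlam : lam' (b' + c') = lam' b' * lam' c' * (D' b' c')⁻¹ := by
        rw [hD'prod' b' c']; group
      have hκ_part : (g ^ m)⁻¹ * (lam' (b' + c'))⁻¹ * g ^ m * lam' (b' + c') =
          ((g ^ m)⁻¹ * (lam' b')⁻¹ * g ^ m * lam' b') * ((g ^ m)⁻¹ * (lam' c')⁻¹ * g ^ m * lam' c') := by
        rw [hlam, ts_kappa_mul_right Z hZc hsqZ, ts_kappa_mul_right Z hZc hsqZ,
          ts_kappa_central_right Z hZc _ _ (Z.inv_mem (hD'Z _ _)), mul_one]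
      rw [hsq_part, hD'r, hκ_part]
      exact ts_rearrange Z hZc _ _ _ _ _ _ (Z.pow_mem hg2 _) (hD'Z _ _)

end TwoStepAux

/-! ## The structure theorem -/

/-- **Stub S — `TwoStepStructure`** (line `csp-spine-meet-to-join`, rev 4): a finite group with all
squares central and `g⁴ = 1` has bilinear two-step coordinates `G ≃ 𝔽₂^k × 𝔽₂^l`. [folklore] -/
theorem stub_twoStepStructure :
    ∀ (G : Type) [Group G] [Fintype G],
      (∀ a y : G, a ^ 2 * y = y * a ^ 2) → (∀ a : G, a ^ 4 = 1) →
      ∃ (k l : ℕ) (x : G → Fin k → ZMod 2) (z : G → Fin l → ZMod 2)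
        (β : (Fin k → ZMod 2) → (Fin k → ZMod 2) → Fin l → ZMod 2),
        2 ^ k * 2 ^ l = Fintype.card G ∧
        (Function.Bijective (fun g => (x g, z g)) ∧ (∀ g h, x (g * h) = x g + x h) ∧
          (∀ g h, z (g * h) = z g + z h + β (x g) (x h)) ∧
          (∀ a a' b, β (a + a') b = β a b + β a' b) ∧ (∀ a b b', β a (b + b') = β a b + β a b')) := by
  intro G _ _ hsq hexp
  classical
  haveI : Fact (Nat.Prime 2) := ⟨Nat.prime_two⟩
  let Z : Subgroup G :=
    { carrier := {g | (∀ y : G, g * y = y * g) ∧ g * g = 1}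
      one_mem' := ⟨fun y => by simp, by simp⟩
      mul_mem' := by
        rintro a b ⟨ha, ha2⟩ ⟨hb, hb2⟩
        refine ⟨fun y => by rw [mul_assoc, hb y, ← mul_assoc, ha y, mul_assoc], ?_⟩
        rw [show a * b * (a * b) = a * (b * a) * b by group, hb a,
          show a * (a * b) * b = (a * a) * (b * b) by group, ha2, hb2, one_mul]
      inv_mem' := by
        rintro a ⟨ha, ha2⟩
        refine ⟨fun y => ?_, by rw [show a⁻¹ * a⁻¹ = (a * a)⁻¹ by group, ha2, inv_one]⟩
        rw [show a⁻¹ * y = (y⁻¹ * a)⁻¹ by group, ← ha y⁻¹]; group }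
  have hZc : ∀ c ∈ Z, ∀ y : G, c * y = y * c := fun c hc y => hc.1 y
  have hZ2 : ∀ c ∈ Z, c * c = 1 := fun c hc => hc.2
  have hsqZ : ∀ a : G, a ^ 2 ∈ Z := fun a =>
    ⟨fun y => hsq a y, by rw [← pow_add]; exact hexp a⟩
  haveI hZn : Z.Normal := ⟨fun n hn g => by
    have : g * n * g⁻¹ = n := by rw [mul_assoc, hZc n hn g⁻¹, ← mul_assoc, mul_inv_cancel, one_mul]
    rw [this]; exact hn⟩
  have hcommQ : ∀ p q : G ⧸ Z, p * q = q * p := by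
    intro p q
    induction p using QuotientGroup.induction_on with | H a => ?_
    induction q using QuotientGroup.induction_on with | H b => ?_
    rw [← QuotientGroup.mk_mul, ← QuotientGroup.mk_mul, QuotientGroup.eq]
    have : (a * b)⁻¹ * (b * a) = b⁻¹ * a⁻¹ * b * a := by group
    rw [this]; exact ts_kappa_mem Z hZc hsqZ b a
  letI cgQ : CommGroup (G ⧸ Z) := CommGroup.mk hcommQ
  letI modV : Module (ZMod 2) (Additive (G ⧸ Z)) := AddCommGroup.zmodModule (by
    intro v
    rw [two_nsmul]
    apply Additive.toMul.injective
    rw [toMul_add, toMul_zero]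
    obtain ⟨a, ha⟩ := QuotientGroup.mk_surjective (Additive.toMul v)
    rw [← ha, ← QuotientGroup.mk_mul, QuotientGroup.eq_one_iff, ← pow_two]
    exact hsqZ a)
  have hcommZ : ∀ u w : Z, u * w = w * u := fun u w => Subtype.ext (hZc u u.2 w)
  letI cgZ : CommGroup Z := CommGroup.mk hcommZ
  letI modZ : Module (ZMod 2) (Additive Z) := AddCommGroup.zmodModule (by
    intro v
    rw [two_nsmul]
    apply Additive.toMul.injective
    rw [toMul_add, toMul_zero]
    exact Subtype.ext (hZ2 _ (Additive.toMul v).2))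
  set k : ℕ := Module.finrank (ZMod 2) (Additive (G ⧸ Z)) with hk; set l : ℕ := Module.finrank (ZMod 2) (Additive Z) with hl
  let bV := Module.finBasis (ZMod 2) (Additive (G ⧸ Z))
  let bZ := Module.finBasis (ZMod 2) (Additive Z)
  let x : G → Fin k → ZMod 2 := fun g => ⇑(bV.repr (Additive.ofMul (QuotientGroup.mk g)))
  have hx_mul : ∀ g h : G, x (g * h) = x g + x h := fun g h => by
    simp only [x, QuotientGroup.mk_mul, ofMul_mul, map_add, Finsupp.coe_add]
  have hx_one : x 1 = 0 := by simp only [x, QuotientGroup.mk_one, ofMul_one, map_zero, Finsupp.coe_zero]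
  have hx_list : ∀ L : List G, x L.prod = (L.map x).sum := by
    intro L; induction L with
    | nil => simp [hx_one]
    | cons g L ih => rw [List.prod_cons, hx_mul, List.map_cons, List.sum_cons, ih]
  have hx_pow : ∀ (g : G) (n : ℕ), x (g ^ n) = n • x g := by
    intro g n; induction n with
    | zero => rw [pow_zero, hx_one, zero_smul]
    | succ n ih => rw [pow_succ, hx_mul, ih, succ_nsmul]
  let gen : Fin k → G := fun i => (Additive.toMul (bV i)).out
  have hx_gen : ∀ i, x (gen i) = Pi.single i 1 := by
    intro i
    simp only [x, gen, QuotientGroup.out_eq', ofMul_toMul, Module.Basis.repr_self,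
      Finsupp.single_eq_pi_single]
  let lam : (Fin k → ZMod 2) → G := fun a => (List.ofFn fun i => gen i ^ (a i).val).prod
  have hx_lam : ∀ a, x (lam a) = a := by
    intro a
    simp only [lam]
    rw [hx_list, List.map_ofFn, List.sum_ofFn]
    funext j
    rw [Finset.sum_apply]
    simp only [Function.comp_apply, hx_pow, hx_gen, Pi.smul_apply, Pi.single_apply, smul_ite,
      smul_zero, Finset.sum_ite_eq, Finset.mem_univ, if_true]
    rw [nsmul_eq_mul, mul_one, ZMod.natCast_zmod_val]
  have hmemZ : ∀ g : G, (lam (x g))⁻¹ * g ∈ Z := by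
    intro g
    rw [← QuotientGroup.eq]
    have h := hx_lam (x g)
    simp only [x] at h
    exact Additive.ofMul.injective (bV.repr.injective (DFunLike.coe_injective h))
  obtain ⟨D, hDZ, hDprod, hDl, hDr⟩ := ts_cocycle Z hZc hsqZ hZ2 k gen
  have hDprod' : ∀ a b, lam a * lam b = lam (a + b) * D a b := fun a b => hDprod a b
  let ζ : G → Z := fun g => ⟨(lam (x g))⁻¹ * g, hmemZ g⟩
  let z : G → Fin l → ZMod 2 := fun g => ⇑(bZ.repr (Additive.ofMul (ζ g)))
  let β : (Fin k → ZMod 2) → (Fin k → ZMod 2) → Fin l → ZMod 2 :=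
    fun a b => ⇑(bZ.repr (Additive.ofMul (⟨D a b, hDZ a b⟩ : Z)))
  have hcardQ : Nat.card (G ⧸ Z) = 2 ^ k := by
    rw [Nat.card_congr (Additive.ofMul (α := G ⧸ Z)), Nat.card_eq_fintype_card,
      Module.card_fintype bV]
    simp [ZMod.card, ← hk]
  have hcardZ : Nat.card Z = 2 ^ l := by
    rw [Nat.card_congr (Additive.ofMul (α := Z)), Nat.card_eq_fintype_card, Module.card_fintype bZ]
    simp [ZMod.card, ← hl]
  have hcard : 2 ^ k * 2 ^ l = Fintype.card G := by
    rw [← Nat.card_eq_fintype_card, Subgroup.card_eq_card_quotient_mul_card_subgroup Z, hcardQ,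
      hcardZ]
  refine ⟨k, l, x, z, β, hcard, ?_, hx_mul, ?_, ?_, ?_⟩
  · refine (Fintype.bijective_iff_injective_and_card _).2 ⟨?_, ?_⟩
    · intro g h hgh
      simp only [Prod.mk.injEq] at hgh
      obtain ⟨hxgh, hzgh⟩ := hgh
      have hζ : ζ g = ζ h := by
        have := DFunLike.coe_injective (F := Fin l →₀ ZMod 2) hzgh
        exact Additive.ofMul.injective (bZ.repr.injective this)
      have hζ' : (lam (x g))⁻¹ * g = (lam (x h))⁻¹ * h := congrArg Subtype.val hζ
      calc g = lam (x g) * ((lam (x g))⁻¹ * g) := by group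
        _ = lam (x h) * ((lam (x h))⁻¹ * h) := by rw [hζ', hxgh]
        _ = h := by group
    · rw [← hcard, Fintype.card_prod, Fintype.card_fun, Fintype.card_fun, Fintype.card_fin,
        Fintype.card_fin, ZMod.card]
  · intro g h
    have hζgh : ζ (g * h) = ⟨D (x g) (x h), hDZ _ _⟩ * ζ g * ζ h := by
      apply Subtype.ext
      simp only [ζ, Subgroup.coe_mul]
      have hcen : (lam (x g))⁻¹ * g * (lam (x h))⁻¹ = (lam (x h))⁻¹ * ((lam (x g))⁻¹ * g) :=
        hZc _ (hmemZ g) _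
      have hl : lam (x (g * h)) = lam (x g) * lam (x h) * (D (x g) (x h))⁻¹ := by
        rw [hx_mul, hDprod' (x g) (x h)]; group
      calc (lam (x (g * h)))⁻¹ * (g * h)
          = D (x g) (x h) * ((lam (x h))⁻¹ * ((lam (x g))⁻¹ * g)) * h := by rw [hl]; group
        _ = D (x g) (x h) * ((lam (x g))⁻¹ * g * (lam (x h))⁻¹) * h := by rw [hcen]
        _ = D (x g) (x h) * ((lam (x g))⁻¹ * g) * ((lam (x h))⁻¹ * h) := by group
    dsimp only [z, β]
    rw [hζgh, ofMul_mul, ofMul_mul, map_add, map_add, Finsupp.coe_add, Finsupp.coe_add]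
    abel
  · intro a a' b
    have e : (⟨D (a + a') b, hDZ _ _⟩ : Z) = ⟨D a b, hDZ a b⟩ * ⟨D a' b, hDZ a' b⟩ :=
      Subtype.ext (hDl a a' b)
    dsimp only [β]; rw [e, ofMul_mul, map_add, Finsupp.coe_add]
  · intro a b b'
    have e : (⟨D a (b + b'), hDZ _ _⟩ : Z) = ⟨D a b, hDZ a b⟩ * ⟨D a b', hDZ a b'⟩ :=
      Subtype.ext (hDr a b b')
    dsimp only [β]; rw [e, ofMul_mul, map_add, Finsupp.coe_add]

end Summit.PneNP.PneNP.Cruxes.Capture.CspSpineMeetToJoin
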